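import Literature.Analysis.FluidPDE.ElgindiAngularLeibniz
import Literature.Analysis.FluidPDE.ElgindiAngularLevelIBP
import Literature.Analysis.FluidPDE.ElgindiPolarEnergyWeighted
import Mathlib.Data.Nat.Choose.Bounds
import HarnessLib

/-!
# The level-`k` angular energy estimate of Elgindi's `𝓗ᵏ` elliptic theory
([Elgindi2021] §7.3 Steps 4–5, §7.4 Proposition 7.9; [ElgindiGhoulMasmoudi2021] §6 Theorem 3)

Topic `Literature/Analysis/FluidPDE`. Proof file (everything proved, no definitions, no named
facts) on the proof path of the named fact
`Literature.Analysis.FluidPDE.Elgindi.ElgindiGhoulMasmoudi2021_stabilityCore`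
(`ElgindiStabilityDecomposition.lean`). T. M. Elgindi, Ann. of Math. 194 (2021) =
arXiv:1904.04795, §7.4 (p. 23 of the held text), and T. M. Elgindi, T.-E. Ghoul, N. Masmoudi,
Camb. J. Math. 9 (2021) = arXiv:1910.14071, §6 (p. 15):

> "Now we wish to show that the following quantity is non-positive up to lower order terms
> `(∂_θ^{k+1}(tan(θ)Ψ), ∂_θ^{k+2}Ψ sin(2θ)^{2k−γ})_{L²_θ}`. It is natural to consider `Ψ̃ = Ψ/cos(θ)`
> so that we wish to study: `(∂_θ^{k+1}(sin(θ)Ψ̃), ∂_θ^{k+2}(cos(θ)Ψ̃) sin(2θ)^{2k−γ})_{L²_θ}`.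
> By induction on `k`, it suffices to consider only the following three terms […]
> `≤ 0` […] where `E` is lower order and satisfies `|Ew²|_{L¹_R} ≤ C|F|_{𝓗ᵏ}`.
> By induction on `k` we now have the following theorem. **Theorem 3.** […]"

This file proves the level-`k` step in a self-contained a-priori form, for the class `Φ = cos θ·φ`
(`φ ∈ C^{k+2}(ℝ²)` compactly supported inside `R > 0`), an arbitrary radial weight `W ≥ 0`
continuous on `(0,∞)`, and an arbitrary level weight `sin(2θ)^r`, `0 ≤ r ≤ 2k+2` (`r = 2k − γ`
downstream). Writing `A_k := −∂_θ^{k+2}Φ + ∂_θ^{k+1}(sin θ·φ)` (= `∂_θ^k` of the angular equation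
`−∂_θθΦ + ∂_θ(tan θΦ) = G`), `N_m := ∫∫ W (∂_θ^mφ)² sin(2θ)^r`:

  `∫∫ W (∂_θ^{k+2}Φ)² sin(2θ)^r + N_{k+1} ≤ 8∫∫ W A_k² sin(2θ)^r + (k+1)·4^{k+4}·Σ_{m≤k} N_m`

(`angular_level_estimate`). PROOF (a streamlined form of the printed computation): expanding only the
first factor, `−∫∫W ∂^{k+1}(sin θφ)·∂^{k+2}Φ = −Σ_a C(k+1,a)∫∫W sin^{(a)}θ φ^{(k+1−a)}∂^{k+2}Φ`; the
terms `a ≥ 1` and, after expanding `∂^{k+2}Φ = Σ_b C(k+2,b)cos^{(b)}θ φ^{(k+2−b)}` in the term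
`a = 0`, the terms `b ≥ 2` are lower order and are bounded POINTWISE by Young's inequality
(`|sin^{(a)}|, |cos^{(b)}| ≤ 1`); the term `b = 1` is `+(k+2)∫∫W sin²θ(φ^{(k+1)})²`; the term `b = 0`
is the single integration by parts `∫ sin θcos θ φ^{(k+1)}φ^{(k+2)} sin(2θ)^r =
−((r+1)/2)∫cos(2θ)(φ^{(k+1)})² sin(2θ)^r` (`ElgindiAngularLevelIBP.lean`), and the resulting coefficient
`(k+2)sin²θ + ((r+1)/2)cos 2θ = (r+1)/2 + (k+1−r)sin²θ ≥ 1/2`.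
-/

noncomputable section

open MeasureTheory Set Real Filter Function Finset
open _root_.Topology

namespace Literature.Analysis.FluidPDE

namespace Elgindi

/-! ### Real-variable tools -/

/-- Pointwise Young with a bounded coefficient: `|t| ≤ 1`, `ε > 0` give `t f g ≤ εf² + g²/(4ε)`. [folklore] -/
theorem mul_mul_le_young {t f g ε : ℝ} (ht : |t| ≤ 1) (hε : 0 < ε) : t * f * g ≤ ε * f ^ 2 + 1 / (4 * ε) * g ^ 2 := by
  have h1 : t * f * g ≤ |f * g| := by
    have := abs_le.1 (show |t * (f * g)| ≤ |f * g| by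
      rw [abs_mul]; exact (mul_le_mul_of_nonneg_right ht (abs_nonneg _)).trans (by rw [one_mul]))
    linarith [this.2, show t * f * g = t * (f * g) by ring]
  have h2 : |f * g| ≤ ε * f ^ 2 + 1 / (4 * ε) * g ^ 2 := by
    rw [abs_le]
    constructor
    · have e : ε * f ^ 2 + 1 / (4 * ε) * g ^ 2 + f * g = ε * (f + g / (2 * ε)) ^ 2 := by field_simp; ring
      nlinarith [e, mul_nonneg hε.le (sq_nonneg (f + g / (2 * ε)))]
    · have e : ε * f ^ 2 + 1 / (4 * ε) * g ^ 2 - f * g = ε * (f - g / (2 * ε)) ^ 2 := by field_simp; ring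
      nlinarith [e, mul_nonneg hε.le (sq_nonneg (f - g / (2 * ε)))]
  exact h1.trans h2

/-- `−AX ≤ 2A² + X²/8`. [folklore] -/
theorem neg_mul_le_two_sq_add (A X : ℝ) : -(A * X) ≤ 2 * A ^ 2 + 1 / 8 * X ^ 2 := by
  nlinarith [sq_nonneg (A + X / 4)]

/-- The level bookkeeping on named reals. [folklore] -/
theorem level_algebra {M N1 G B0 Sb Sa Asq SN K1 K2 K : ℝ} (hM : 0 ≤ M) (hAsq : 0 ≤ Asq) (hSN : 0 ≤ SN)
    (hid : M + G = B0 + Sb + Sa) (hq : 1 / 2 * N1 ≤ G) (hB0 : B0 ≤ 2 * Asq + 1 / 8 * M)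
    (hSb : Sb ≤ 1 / 8 * N1 + K1 * SN) (hSa : Sa ≤ 1 / 8 * M + K2 * SN) (hK : 8 * (K1 + K2) ≤ 3 * K) :
    M + N1 ≤ 8 * Asq + K * SN := by
  nlinarith [mul_le_mul_of_nonneg_right hK hSN]

/-- The level coefficient is at least one half: `(k+2)sin²θ + ((r+1)/2)cos 2θ ≥ 1/2` for
`0 ≤ r ≤ 2k+2`. [cite: Elgindi2021, §7.4 proof of Proposition 7.9, final display "≤ 0" (p. 23 of arXiv:1904.04795)] -/
theorem level_coeff_ge_half {i : ℕ} {r : ℝ} (hr0 : 0 ≤ r) (hr1 : r ≤ 2 * i + 2) (θ : ℝ) :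
    1 / 2 ≤ ((i : ℝ) + 2) * Real.sin θ ^ 2 + (r + 1) / 2 * Real.cos (2 * θ) := by
  rw [Real.cos_two_mul, ← Real.sin_sq_add_cos_sq θ]
  have hs : Real.sin θ ^ 2 ≤ 1 := Real.sin_sq_le_one θ
  have hs0 : 0 ≤ Real.sin θ ^ 2 := sq_nonneg _
  have hc : Real.sin θ ^ 2 + Real.cos θ ^ 2 = 1 := Real.sin_sq_add_cos_sq θ
  rcases le_or_gt r (i + 1) with h | h
  · nlinarith
  · nlinarith

/-! ### The level estimate -/

set_option maxHeartbeats 1600000 in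
/-- **The level-`k` angular energy estimate** (see the module docstring): for `Φ = cos θ·φ` with
`φ ∈ C^{k+2}(ℝ²)` compactly supported inside `R > 0`, a radial weight `W ≥ 0` continuous on
`(0,∞)`, and `0 ≤ r ≤ 2k+2`,
`∫∫ W(∂^{k+2}Φ)²s^r + ∫∫ W(∂^{k+1}φ)²s^r ≤ 8∫∫ W(−∂^{k+2}Φ + ∂^{k+1}(sin θφ))²s^r + (k+1)4^{k+4}Σ_{m≤k}∫∫ W(∂^mφ)²s^r`
(`s = sin 2θ`). [cite: Elgindi2021, §7.4 Proposition 7.9 and its proof (p. 23 of arXiv:1904.04795)]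
[cite: ElgindiGhoulMasmoudi2021, §6 Theorem 3 and its proof (p. 15 of arXiv:1910.14071)] -/
theorem angular_level_estimate (i : ℕ) {r : ℝ} (hr0 : 0 ≤ r) (hr1 : r ≤ 2 * i + 2) {W : ℝ → ℝ}
    (hWc : ContinuousOn W (Ioi 0)) (hW0 : ∀ R, 0 < R → 0 ≤ W R) {φ : ℝ → ℝ → ℝ}
    (hφ : ContDiff ℝ (i + 2) (uncurry φ)) (hs : HasCompactSupport (uncurry φ))
    (hpos : ∀ p ∈ tsupport (uncurry φ), 0 < p.1) {Φ : ℝ → ℝ → ℝ} (hΦ : Φ = fun R θ => Real.cos θ * φ R θ) :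
    (∫ p in strip, W p.1 * (dθ^[i + 2] Φ) p.1 p.2 ^ 2 * Real.sin (2 * p.2) ^ r) +
        (∫ p in strip, W p.1 * (dθ^[i + 1] φ) p.1 p.2 ^ 2 * Real.sin (2 * p.2) ^ r) ≤
      8 * (∫ p in strip, W p.1 * (-(dθ^[i + 2] Φ) p.1 p.2 + (dθ^[i + 1] fun R θ => Real.sin θ * φ R θ) p.1 p.2) ^ 2 *
          Real.sin (2 * p.2) ^ r) +
        ((i : ℝ) + 1) * 4 ^ (i + 4) * ∑ m ∈ range (i + 1), ∫ p in strip, W p.1 * (dθ^[m] φ) p.1 p.2 ^ 2 * Real.sin (2 * p.2) ^ r := by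
  ----------------------------------------------------------------
  -- regularity, support, vanishing near the axis
  ----------------------------------------------------------------
  obtain ⟨S, hS⟩ : ∃ S : ℝ → ℝ → ℝ, S = fun R θ => Real.sin θ * φ R θ := ⟨_, rfl⟩
  have hφ1 : ContDiff ℝ (i + 1) (uncurry φ) := hφ.of_le (by exact_mod_cast Nat.le_succ _)
  have hΦc : ContDiff ℝ (i + 2) (uncurry Φ) := by rw [hΦ]; exact contDiff_cosProfile hφ
  have hSc : ContDiff ℝ (i + 2) (uncurry S) := by
    rw [hS]
    have e : uncurry (fun R θ => Real.sin θ * φ R θ) = fun p : ℝ × ℝ => Real.sin p.2 * uncurry φ p := by funext p; rfl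
    rw [e]; exact (Real.contDiff_sin.comp contDiff_snd).mul hφ
  have hΦs : HasCompactSupport (uncurry Φ) := by rw [hΦ]; exact hasCompactSupport_cosProfile hs
  have hSs : HasCompactSupport (uncurry S) := by
    rw [hS]
    have e : uncurry (fun R θ => Real.sin θ * φ R θ) = fun p : ℝ × ℝ => Real.sin p.2 * uncurry φ p := by funext p; rfl
    rw [e]; exact hs.mul_left
  -- continuity of the iterates (up to the available order)
  have cont_iter : ∀ {g : ℝ → ℝ → ℝ}, ContDiff ℝ (i + 2) (uncurry g) → ∀ m, m ≤ i + 2 →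
      Continuous fun p : ℝ × ℝ => (dθ^[m] g) p.1 p.2 := by
    intro g hg m hm
    have h : ContDiff ℝ (((i + 2 - m) + m : ℕ) : WithTop ℕ∞) (uncurry g) := by
      rw [Nat.sub_add_cancel hm]; exact_mod_cast hg
    exact (contDiff_iterate_dθ_of_contDiff (n := m) (m := i + 2 - m) h).continuous
  obtain ⟨a, ha, hva⟩ := exists_pos_forall_fst_lt_eq_zero hs hpos
  have hvaφ : ∀ p : ℝ × ℝ, p.1 < a → φ p.1 p.2 = 0 := fun p hp => hva p hp
  have hvaΦ : ∀ p : ℝ × ℝ, p.1 < a → Φ p.1 p.2 = 0 := fun p hp => by rw [hΦ]; simp [hvaφ p hp]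
  have hvaS : ∀ p : ℝ × ℝ, p.1 < a → S p.1 p.2 = 0 := fun p hp => by rw [hS]; simp [hvaφ p hp]
  have va_iter : ∀ {g : ℝ → ℝ → ℝ}, (∀ p : ℝ × ℝ, p.1 < a → g p.1 p.2 = 0) → ∀ m, ∀ p : ℝ × ℝ, p.1 < a → (dθ^[m] g) p.1 p.2 = 0 :=
    fun hg m => iterate_dθ_eq_zero_of_fst_lt hg m
  have hsin : ∀ p ∈ strip, 0 < Real.sin (2 * p.2) := fun p hp =>
    Real.sin_pos_of_pos_of_lt_pi (by linarith [hp.2.1]) (by linarith [hp.2.2])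
  have cρ : Continuous fun θ : ℝ => Real.sin (2 * θ) ^ r := continuous_sin_two_mul_rpow hr0
  ----------------------------------------------------------------
  -- generic integrability: `W·g·sin(2θ)^r` for continuous compactly supported `g` vanishing for `R < a`
  ----------------------------------------------------------------
  have supp_of : ∀ (Fn : ℝ × ℝ → ℝ) (g : ℝ × ℝ → ℝ), HasCompactSupport g → (∀ p, g p = 0 → Fn p = 0) → HasCompactSupport Fn :=
    fun Fn g hg h => hg.mono fun p hp => by
      contrapose! hp
      simp only [mem_support, ne_eq, not_not] at hp ⊢
      exact h p hp
  have iWρ : ∀ (g : ℝ × ℝ → ℝ), Continuous g → HasCompactSupport g → (∀ p : ℝ × ℝ, p.1 < a → g p = 0) →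
      Integrable fun p : ℝ × ℝ => W p.1 * g p * Real.sin (2 * p.2) ^ r := by
    intro g hg hgs hga
    have hc : Continuous fun p : ℝ × ℝ => W p.1 * (g p * Real.sin (2 * p.2) ^ r) :=
      continuous_weight_mul₂ hWc (hg.mul (cρ.comp continuous_snd)) ha fun p hp => by simp [hga p hp]
    have hc' : Continuous fun p : ℝ × ℝ => W p.1 * g p * Real.sin (2 * p.2) ^ r := hc.congr fun p => by ring
    exact hc'.integrable_of_hasCompactSupport (supp_of _ g hgs fun p hp => by simp [hp])
  -- the iterates as plane functions
  have cφm : ∀ m, m ≤ i + 2 → Continuous fun p : ℝ × ℝ => (dθ^[m] φ) p.1 p.2 := cont_iter hφ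
  have cΦm : ∀ m, m ≤ i + 2 → Continuous fun p : ℝ × ℝ => (dθ^[m] Φ) p.1 p.2 := cont_iter hΦc
  have cSm : ∀ m, m ≤ i + 2 → Continuous fun p : ℝ × ℝ => (dθ^[m] S) p.1 p.2 := cont_iter hSc
  have sφm : ∀ m, HasCompactSupport fun p : ℝ × ℝ => (dθ^[m] φ) p.1 p.2 := fun m => hasCompactSupport_iterate_dθ hs m
  have sΦm : ∀ m, HasCompactSupport fun p : ℝ × ℝ => (dθ^[m] Φ) p.1 p.2 := fun m => hasCompactSupport_iterate_dθ hΦs m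
  have vφm : ∀ m, ∀ p : ℝ × ℝ, p.1 < a → (dθ^[m] φ) p.1 p.2 = 0 := fun m => va_iter hvaφ m
  have vΦm : ∀ m, ∀ p : ℝ × ℝ, p.1 < a → (dθ^[m] Φ) p.1 p.2 = 0 := fun m => va_iter hvaΦ m
  have vSm : ∀ m, ∀ p : ℝ × ℝ, p.1 < a → (dθ^[m] S) p.1 p.2 = 0 := fun m => va_iter hvaS m
  ----------------------------------------------------------------
  -- the named pointwise quantities
  ----------------------------------------------------------------
  -- X = ∂^{i+2}Φ, Y = ∂^{i+1}φ, Z = ∂^{i+2}φ, A = −X + ∂^{i+1}S, lower-order factors φ^{(i−m)}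
  obtain ⟨X, hX⟩ : ∃ X : ℝ × ℝ → ℝ, X = fun p => (dθ^[i + 2] Φ) p.1 p.2 := ⟨_, rfl⟩
  obtain ⟨Y, hY⟩ : ∃ Y : ℝ × ℝ → ℝ, Y = fun p => (dθ^[i + 1] φ) p.1 p.2 := ⟨_, rfl⟩
  obtain ⟨Z, hZ⟩ : ∃ Z : ℝ × ℝ → ℝ, Z = fun p => (dθ^[i + 2] φ) p.1 p.2 := ⟨_, rfl⟩
  obtain ⟨A, hA⟩ : ∃ A : ℝ × ℝ → ℝ, A = fun p => -(dθ^[i + 2] Φ) p.1 p.2 + (dθ^[i + 1] S) p.1 p.2 := ⟨_, rfl⟩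
  have cX : Continuous X := by rw [hX]; exact cΦm (i + 2) le_rfl
  have cY : Continuous Y := by rw [hY]; exact cφm (i + 1) (Nat.le_succ _)
  have cZ : Continuous Z := by rw [hZ]; exact cφm (i + 2) le_rfl
  have cA : Continuous A := by rw [hA]; exact (cΦm (i + 2) le_rfl).neg.add (cSm (i + 1) (Nat.le_succ _))
  have sX : HasCompactSupport X := by rw [hX]; exact sΦm (i + 2)
  have sY : HasCompactSupport Y := by rw [hY]; exact sφm (i + 1)
  have vX : ∀ p : ℝ × ℝ, p.1 < a → X p = 0 := fun p hp => by rw [hX]; exact vΦm _ p hp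
  have vY : ∀ p : ℝ × ℝ, p.1 < a → Y p = 0 := fun p hp => by rw [hY]; exact vφm _ p hp
  have vZ : ∀ p : ℝ × ℝ, p.1 < a → Z p = 0 := fun p hp => by rw [hZ]; exact vφm _ p hp
  have vA : ∀ p : ℝ × ℝ, p.1 < a → A p = 0 := fun p hp => by rw [hA]; simp [vΦm _ p hp, vSm _ p hp]
  -- the lower-order factors `L m = φ^{(i−m)}` for `m ≤ i`
  have cL : ∀ m, Continuous fun p : ℝ × ℝ => (dθ^[i - m] φ) p.1 p.2 := fun m => cφm (i - m) (by omega)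
  ----------------------------------------------------------------
  -- the Leibniz expansions at a point
  ----------------------------------------------------------------
  have hLeibS : ∀ p : ℝ × ℝ, (dθ^[i + 1] S) p.1 p.2 = Real.sin p.2 * Y p +
      ∑ a ∈ range (i + 1), ((i + 1).choose (a + 1) : ℝ) * iteratedDeriv (a + 1) Real.sin p.2 * (dθ^[i - a] φ) p.1 p.2 := by
    intro p
    rw [hS, iterate_dθ_sin_mul hφ1, Finset.sum_range_succ']
    simp only [Nat.choose_zero_right, Nat.cast_one, iteratedDeriv_zero, Nat.sub_zero, one_mul, Nat.add_sub_add_right]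
    rw [hY]
    ring
  have hcos1 : ∀ θ : ℝ, iteratedDeriv 1 Real.cos θ = -Real.sin θ := fun θ => by
    rw [iteratedDeriv_one]; exact (Real.hasDerivAt_cos θ).deriv
  have hLeibΦ : ∀ p : ℝ × ℝ, X p = Real.cos p.2 * Z p - ((i : ℝ) + 2) * Real.sin p.2 * Y p +
      ∑ b ∈ range (i + 1), ((i + 2).choose (b + 2) : ℝ) * iteratedDeriv (b + 2) Real.cos p.2 * (dθ^[i - b] φ) p.1 p.2 := by
    intro p
    rw [hX, hΦ]
    simp only []
    have e2 : ∀ b : ℕ, b + 1 + 1 = b + 2 := fun b => rfl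
    rw [iterate_dθ_cos_mul hφ, Finset.sum_range_succ', Finset.sum_range_succ']
    simp only [Nat.choose_zero_right, Nat.cast_one, iteratedDeriv_zero, Nat.sub_zero, one_mul, zero_add, e2,
      Nat.add_sub_add_right, Nat.choose_one_right, hcos1]
    rw [hZ, hY]
    push_cast
    ring
  ----------------------------------------------------------------
  -- the pointwise identity (★)
  ----------------------------------------------------------------
  -- lower-order integrands
  obtain ⟨Tb, hTb⟩ : ∃ Tb : ℕ → ℝ × ℝ → ℝ, Tb = fun b p => ((i + 2).choose (b + 2) : ℝ) * iteratedDeriv (b + 2) Real.cos p.2 *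
      (dθ^[i - b] φ) p.1 p.2 * (Real.sin p.2 * Y p) := ⟨_, rfl⟩
  obtain ⟨Ta, hTa⟩ : ∃ Ta : ℕ → ℝ × ℝ → ℝ, Ta = fun a' p => ((i + 1).choose (a' + 1) : ℝ) * iteratedDeriv (a' + 1) Real.sin p.2 *
      (dθ^[i - a'] φ) p.1 p.2 * X p := ⟨_, rfl⟩
  have hstar : ∀ p : ℝ × ℝ, X p ^ 2 + ((i : ℝ) + 2) * (Real.sin p.2 ^ 2 * Y p ^ 2) =
      -(A p * X p) + Real.sin p.2 * Real.cos p.2 * Y p * Z p + ∑ b ∈ range (i + 1), Tb b p + ∑ a' ∈ range (i + 1), Ta a' p := by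
    intro p
    have h1 : A p = -X p + (Real.sin p.2 * Y p + ∑ a ∈ range (i + 1), ((i + 1).choose (a + 1) : ℝ) *
        iteratedDeriv (a + 1) Real.sin p.2 * (dθ^[i - a] φ) p.1 p.2) := by
      rw [hA]; simp only []; rw [hLeibS p, hX]
    have h2 := hLeibΦ p
    have eb : ∑ b ∈ range (i + 1), Tb b p = Real.sin p.2 * Y p * ∑ b ∈ range (i + 1), ((i + 2).choose (b + 2) : ℝ) *
        iteratedDeriv (b + 2) Real.cos p.2 * (dθ^[i - b] φ) p.1 p.2 := by
      rw [hTb, Finset.mul_sum]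
      exact Finset.sum_congr rfl fun b _ => by ring
    have ea : ∑ a' ∈ range (i + 1), Ta a' p = X p * ∑ a ∈ range (i + 1), ((i + 1).choose (a + 1) : ℝ) *
        iteratedDeriv (a + 1) Real.sin p.2 * (dθ^[i - a] φ) p.1 p.2 := by
      rw [hTa, Finset.mul_sum]
      exact Finset.sum_congr rfl fun a _ => by ring
    rw [eb, ea]
    -- abstract the two sums
    generalize (∑ b ∈ range (i + 1), ((i + 2).choose (b + 2) : ℝ) * iteratedDeriv (b + 2) Real.cos p.2 * (dθ^[i - b] φ) p.1 p.2) = σb at h2 ⊢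
    generalize (∑ a ∈ range (i + 1), ((i + 1).choose (a + 1) : ℝ) * iteratedDeriv (a + 1) Real.sin p.2 * (dθ^[i - a] φ) p.1 p.2) = σa at h1 ⊢
    rw [h1]
    linear_combination (Real.sin p.2 * Y p) * h2
  ----------------------------------------------------------------
  -- integrability of every piece
  ----------------------------------------------------------------
  have iXX : Integrable fun p : ℝ × ℝ => W p.1 * X p ^ 2 * Real.sin (2 * p.2) ^ r :=
    iWρ _ (cX.pow 2) (supp_of _ X sX fun p hp => by simp [hp]) fun p hp => by simp [vX p hp]
  have iSY : Integrable fun p : ℝ × ℝ => W p.1 * (Real.sin p.2 ^ 2 * Y p ^ 2) * Real.sin (2 * p.2) ^ r :=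
    iWρ _ (by fun_prop) (supp_of _ Y sY fun p hp => by simp [hp]) fun p hp => by simp [vY p hp]
  have iAX : Integrable fun p : ℝ × ℝ => W p.1 * (-(A p * X p)) * Real.sin (2 * p.2) ^ r :=
    iWρ _ (by fun_prop) (supp_of _ X sX fun p hp => by simp [hp]) fun p hp => by simp [vX p hp]
  have iT0 : Integrable fun p : ℝ × ℝ => W p.1 * (Real.sin p.2 * Real.cos p.2 * Y p * Z p) * Real.sin (2 * p.2) ^ r :=
    iWρ _ (by fun_prop) (supp_of _ Y sY fun p hp => by simp [hp]) fun p hp => by simp [vY p hp]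
  have iTb : ∀ b ∈ range (i + 1), Integrable fun p : ℝ × ℝ => W p.1 * Tb b p * Real.sin (2 * p.2) ^ r := by
    intro b _
    rw [hTb]
    refine iWρ _ ?_ (supp_of _ Y sY fun p hp => by simp [hp]) fun p hp => by simp [vY p hp]
    have := cL b; have := cY; fun_prop
  have iTa : ∀ a' ∈ range (i + 1), Integrable fun p : ℝ × ℝ => W p.1 * Ta a' p * Real.sin (2 * p.2) ^ r := by
    intro a' _
    rw [hTa]
    refine iWρ _ ?_ (supp_of _ X sX fun p hp => by simp [hp]) fun p hp => by simp [vX p hp]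
    have := cL a'; have := cX; fun_prop
  have iYY : Integrable fun p : ℝ × ℝ => W p.1 * Y p ^ 2 * Real.sin (2 * p.2) ^ r :=
    iWρ _ (cY.pow 2) (supp_of _ Y sY fun p hp => by simp [hp]) fun p hp => by simp [vY p hp]
  have iCY : Integrable fun p : ℝ × ℝ => W p.1 * (Real.cos (2 * p.2) * Y p ^ 2) * Real.sin (2 * p.2) ^ r :=
    iWρ _ (by fun_prop) (supp_of _ Y sY fun p hp => by simp [hp]) fun p hp => by simp [vY p hp]
  have sA : HasCompactSupport A := by
    have h := sX.neg.add (hasCompactSupport_iterate_dθ hSs (i + 1))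
    rw [hX] at h
    rw [hA]
    exact h
  have iAA : Integrable fun p : ℝ × ℝ => W p.1 * A p ^ 2 * Real.sin (2 * p.2) ^ r :=
    iWρ _ (cA.pow 2) (supp_of _ A sA fun p hp => by simp [hp]) fun p hp => by simp [vA p hp]
  have iL : ∀ m, Integrable fun p : ℝ × ℝ => W p.1 * (dθ^[i - m] φ) p.1 p.2 ^ 2 * Real.sin (2 * p.2) ^ r := fun m =>
    iWρ _ ((cL m).pow 2) (supp_of _ _ (sφm (i - m)) fun p hp => by simp [show (dθ^[i - m] φ) p.1 p.2 = 0 from hp])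
      fun p hp => by simp [vφm _ p hp]
  have iSumb : Integrable fun p : ℝ × ℝ => ∑ b ∈ range (i + 1), W p.1 * Tb b p * Real.sin (2 * p.2) ^ r :=
    integrable_finsetSum _ iTb
  have iSuma : Integrable fun p : ℝ × ℝ => ∑ a' ∈ range (i + 1), W p.1 * Ta a' p * Real.sin (2 * p.2) ^ r :=
    integrable_finsetSum _ iTa
  ----------------------------------------------------------------
  -- integrate (★) over the strip
  ----------------------------------------------------------------
  have hInt : (∫ p in strip, W p.1 * X p ^ 2 * Real.sin (2 * p.2) ^ r) +
      ((i : ℝ) + 2) * (∫ p in strip, W p.1 * (Real.sin p.2 ^ 2 * Y p ^ 2) * Real.sin (2 * p.2) ^ r) =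
      (∫ p in strip, W p.1 * (-(A p * X p)) * Real.sin (2 * p.2) ^ r) +
      (∫ p in strip, W p.1 * (Real.sin p.2 * Real.cos p.2 * Y p * Z p) * Real.sin (2 * p.2) ^ r) +
      (∑ b ∈ range (i + 1), ∫ p in strip, W p.1 * Tb b p * Real.sin (2 * p.2) ^ r) +
      ∑ a' ∈ range (i + 1), ∫ p in strip, W p.1 * Ta a' p * Real.sin (2 * p.2) ^ r := by
    have hpt : ∀ p : ℝ × ℝ, W p.1 * X p ^ 2 * Real.sin (2 * p.2) ^ r + ((i : ℝ) + 2) * (W p.1 * (Real.sin p.2 ^ 2 * Y p ^ 2) * Real.sin (2 * p.2) ^ r) =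
        W p.1 * (-(A p * X p)) * Real.sin (2 * p.2) ^ r + W p.1 * (Real.sin p.2 * Real.cos p.2 * Y p * Z p) * Real.sin (2 * p.2) ^ r +
        (∑ b ∈ range (i + 1), W p.1 * Tb b p * Real.sin (2 * p.2) ^ r) +
        ∑ a' ∈ range (i + 1), W p.1 * Ta a' p * Real.sin (2 * p.2) ^ r := by
      intro p
      have h := hstar p
      calc W p.1 * X p ^ 2 * Real.sin (2 * p.2) ^ r + ((i : ℝ) + 2) * (W p.1 * (Real.sin p.2 ^ 2 * Y p ^ 2) * Real.sin (2 * p.2) ^ r)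
          = W p.1 * (X p ^ 2 + ((i : ℝ) + 2) * (Real.sin p.2 ^ 2 * Y p ^ 2)) * Real.sin (2 * p.2) ^ r := by ring
        _ = W p.1 * (-(A p * X p) + Real.sin p.2 * Real.cos p.2 * Y p * Z p + ∑ b ∈ range (i + 1), Tb b p +
              ∑ a' ∈ range (i + 1), Ta a' p) * Real.sin (2 * p.2) ^ r := by rw [h]
        _ = W p.1 * (-(A p * X p)) * Real.sin (2 * p.2) ^ r + W p.1 * (Real.sin p.2 * Real.cos p.2 * Y p * Z p) * Real.sin (2 * p.2) ^ r +
              W p.1 * (∑ b ∈ range (i + 1), Tb b p) * Real.sin (2 * p.2) ^ r +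
              W p.1 * (∑ a' ∈ range (i + 1), Ta a' p) * Real.sin (2 * p.2) ^ r := by ring
        _ = _ := by rw [Finset.mul_sum, Finset.mul_sum, Finset.sum_mul, Finset.sum_mul]
    have lhsI : Integrable fun p : ℝ × ℝ => W p.1 * X p ^ 2 * Real.sin (2 * p.2) ^ r + ((i : ℝ) + 2) * (W p.1 * (Real.sin p.2 ^ 2 * Y p ^ 2) * Real.sin (2 * p.2) ^ r) :=
      iXX.add (iSY.const_mul _)
    have k1 : Integrable fun p : ℝ × ℝ => W p.1 * (-(A p * X p)) * Real.sin (2 * p.2) ^ r + W p.1 * (Real.sin p.2 * Real.cos p.2 * Y p * Z p) * Real.sin (2 * p.2) ^ r :=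
      iAX.add iT0
    have k2 : Integrable fun p : ℝ × ℝ => W p.1 * (-(A p * X p)) * Real.sin (2 * p.2) ^ r + W p.1 * (Real.sin p.2 * Real.cos p.2 * Y p * Z p) * Real.sin (2 * p.2) ^ r +
        ∑ b ∈ range (i + 1), W p.1 * Tb b p * Real.sin (2 * p.2) ^ r := k1.add iSumb
    have h := integral_congr_ae (μ := volume.restrict strip) (ae_of_all _ hpt)
    rw [integral_add iXX.integrableOn (iSY.const_mul _).integrableOn, MeasureTheory.integral_const_mul,
      integral_add k2.integrableOn iSuma.integrableOn, integral_add k1.integrableOn iSumb.integrableOn,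
      integral_add iAX.integrableOn iT0.integrableOn,
      integral_finsetSum _ (fun b hb => (iTb b hb).integrableOn), integral_finsetSum _ (fun a' ha' => (iTa a' ha').integrableOn)] at h
    exact h
  ----------------------------------------------------------------
  -- the single integration by parts (slice-wise): `∫∫ W sinθcosθ Y Z s^r = −((r+1)/2)∫∫ W cos2θ Y² s^r`
  ----------------------------------------------------------------
  have hIBP : ∫ p in strip, W p.1 * (Real.sin p.2 * Real.cos p.2 * Y p * Z p) * Real.sin (2 * p.2) ^ r =
      -((r + 1) / 2) * ∫ p in strip, W p.1 * (Real.cos (2 * p.2) * Y p ^ 2) * Real.sin (2 * p.2) ^ r := by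
    have hdiff : Integrable fun p : ℝ × ℝ => W p.1 * (Real.sin p.2 * Real.cos p.2 * Y p * Z p) * Real.sin (2 * p.2) ^ r +
        (r + 1) / 2 * (W p.1 * (Real.cos (2 * p.2) * Y p ^ 2) * Real.sin (2 * p.2) ^ r) := iT0.add (iCY.const_mul _)
    have h0 : ∫ p in strip, (W p.1 * (Real.sin p.2 * Real.cos p.2 * Y p * Z p) * Real.sin (2 * p.2) ^ r +
        (r + 1) / 2 * (W p.1 * (Real.cos (2 * p.2) * Y p ^ 2) * Real.sin (2 * p.2) ^ r)) = 0 := by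
      rw [integral_strip_eq_integral_Ioi_integral_Ioo hdiff]
      refine setIntegral_eq_zero_of_forall_eq_zero fun R hR => ?_
      -- the slice `g = Y(R,·) ∈ C¹`, `g' = Z(R,·)`
      have hg : ContDiff ℝ 1 fun θ => Y (R, θ) := by
        rw [hY]; simp only []
        have h : ContDiff ℝ ((1 + (i + 1) : ℕ) : WithTop ℕ∞) (uncurry φ) := by
          rw [show 1 + (i + 1) = i + 2 by ring]; exact_mod_cast hφ
        have := contDiff_iterate_dθ_of_contDiff (n := i + 1) (m := 1) h
        exact this.comp (contDiff_const.prodMk contDiff_id)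
      have hgd : deriv (fun θ => Y (R, θ)) = fun θ => Z (R, θ) := by
        rw [hY, hZ]; funext θ; simp only []
        rw [show (dθ^[i + 2] φ) = dθ (dθ^[i + 1] φ) from Function.iterate_succ_apply' dθ (i + 1) φ]
        rfl
      have h1 := integral_Ioo_sin_rpow_succ_mul_mul_deriv hr0 hg
      rw [hgd] at h1
      simp only at h1
      -- pointwise `sinθcosθ s^r = ½ s^{r+1}` on the slice
      have e1 : ∫ θ in Ioo 0 (π / 2), W R * (Real.sin θ * Real.cos θ * Y (R, θ) * Z (R, θ)) * Real.sin (2 * θ) ^ r =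
          W R * ((1 / 2) * ∫ θ in Ioo 0 (π / 2), Real.sin (2 * θ) ^ (r + 1) * Y (R, θ) * Z (R, θ)) := by
        rw [← MeasureTheory.integral_const_mul, ← MeasureTheory.integral_const_mul]
        refine setIntegral_congr_fun measurableSet_Ioo fun θ hθ => ?_
        have hs' : 0 < Real.sin (2 * θ) := Real.sin_pos_of_pos_of_lt_pi (by linarith [hθ.1]) (by linarith [hθ.2])
        rw [Real.rpow_add_one hs'.ne', Real.sin_two_mul]; ring
      have e2 : ∫ θ in Ioo 0 (π / 2), (r + 1) / 2 * (W R * (Real.cos (2 * θ) * Y (R, θ) ^ 2) * Real.sin (2 * θ) ^ r) =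
          W R * ((r + 1) / 2 * ∫ θ in Ioo 0 (π / 2), Real.cos (2 * θ) * Real.sin (2 * θ) ^ r * Y (R, θ) ^ 2) := by
        rw [← MeasureTheory.integral_const_mul, ← MeasureTheory.integral_const_mul]
        exact integral_congr_ae (ae_of_all _ fun θ => by ring)
      have j1 : IntegrableOn (fun θ => W R * (Real.sin θ * Real.cos θ * Y (R, θ) * Z (R, θ)) * Real.sin (2 * θ) ^ r) (Ioo 0 (π / 2)) := by
        have c : Continuous fun θ => W R * (Real.sin θ * Real.cos θ * Y (R, θ) * Z (R, θ)) * Real.sin (2 * θ) ^ r := by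
          have := cY.comp (Continuous.prodMk_right R); have := cZ.comp (Continuous.prodMk_right R); have := cρ; fun_prop
        exact (c.continuousOn.integrableOn_Icc (a := 0) (b := π / 2)).mono_set Ioo_subset_Icc_self
      have j2 : IntegrableOn (fun θ => (r + 1) / 2 * (W R * (Real.cos (2 * θ) * Y (R, θ) ^ 2) * Real.sin (2 * θ) ^ r)) (Ioo 0 (π / 2)) := by
        have c : Continuous fun θ => (r + 1) / 2 * (W R * (Real.cos (2 * θ) * Y (R, θ) ^ 2) * Real.sin (2 * θ) ^ r) := by
          have := cY.comp (Continuous.prodMk_right R); have := cρ; fun_prop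
        exact (c.continuousOn.integrableOn_Icc (a := 0) (b := π / 2)).mono_set Ioo_subset_Icc_self
      rw [integral_add j1 j2, e1, e2, h1]
      ring
    have k : IntegrableOn (fun p : ℝ × ℝ => (r + 1) / 2 * (W p.1 * (Real.cos (2 * p.2) * Y p ^ 2) * Real.sin (2 * p.2) ^ r)) strip :=
      (iCY.const_mul _).integrableOn
    rw [integral_add iT0.integrableOn k, MeasureTheory.integral_const_mul] at h0
    linarith
  ----------------------------------------------------------------
  -- the bounds of the four kinds of terms
  ----------------------------------------------------------------
  -- (B0)
  have hB0 : (∫ p in strip, W p.1 * (-(A p * X p)) * Real.sin (2 * p.2) ^ r) ≤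
      2 * (∫ p in strip, W p.1 * A p ^ 2 * Real.sin (2 * p.2) ^ r) + (1 / 8) * ∫ p in strip, W p.1 * X p ^ 2 * Real.sin (2 * p.2) ^ r := by
    rw [← MeasureTheory.integral_const_mul, ← MeasureTheory.integral_const_mul, ← integral_add ((iAA.const_mul _).integrableOn) ((iXX.const_mul _).integrableOn)]
    refine setIntegral_mono_on iAX.integrableOn ((iAA.const_mul _).add (iXX.const_mul _)).integrableOn measurableSet_strip fun p hp => ?_
    have hw := hW0 p.1 hp.1
    have hρ := (hsin p hp).le
    have hρ' : 0 ≤ Real.sin (2 * p.2) ^ r := Real.rpow_nonneg hρ _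
    have := mul_le_mul_of_nonneg_left (neg_mul_le_two_sq_add (A p) (X p)) (mul_nonneg hw hρ')
    nlinarith [this]
  -- (Bb): each `b`
  have hε1 : (0 : ℝ) < 1 / (8 * ((i : ℝ) + 1) * 2 ^ (i + 2)) := by positivity
  have hTb_le : ∀ b ∈ range (i + 1), (∫ p in strip, W p.1 * Tb b p * Real.sin (2 * p.2) ^ r) ≤
      (2 : ℝ) ^ (i + 2) * (1 / (8 * ((i : ℝ) + 1) * 2 ^ (i + 2)) * (∫ p in strip, W p.1 * Y p ^ 2 * Real.sin (2 * p.2) ^ r) +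
        1 / (4 * (1 / (8 * ((i : ℝ) + 1) * 2 ^ (i + 2)))) * ∫ p in strip, W p.1 * (dθ^[i - b] φ) p.1 p.2 ^ 2 * Real.sin (2 * p.2) ^ r) := by
    intro b hb
    set ε : ℝ := 1 / (8 * ((i : ℝ) + 1) * 2 ^ (i + 2)) with hε
    have hC : ((i + 2).choose (b + 2) : ℝ) ≤ 2 ^ (i + 2) := by exact_mod_cast Nat.choose_le_two_pow (i + 2) (b + 2)
    have hC0 : (0 : ℝ) ≤ ((i + 2).choose (b + 2) : ℝ) := Nat.cast_nonneg _
    have iR : Integrable fun p : ℝ × ℝ => (2 : ℝ) ^ (i + 2) * (ε * (W p.1 * Y p ^ 2 * Real.sin (2 * p.2) ^ r) +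
        1 / (4 * ε) * (W p.1 * (dθ^[i - b] φ) p.1 p.2 ^ 2 * Real.sin (2 * p.2) ^ r)) := ((iYY.const_mul _).add ((iL b).const_mul _)).const_mul _
    have hmono := setIntegral_mono_on (s := strip) (iTb b hb).integrableOn iR.integrableOn measurableSet_strip (fun p hp => by
      have hw := hW0 p.1 hp.1
      have hρ' : 0 ≤ Real.sin (2 * p.2) ^ r := Real.rpow_nonneg (hsin p hp).le _
      rw [hTb]; simp only []
      -- `t = cos^{(b+2)} θ · sin θ`, `|t| ≤ 1`
      have ht : |iteratedDeriv (b + 2) Real.cos p.2 * Real.sin p.2| ≤ 1 := by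
        rw [abs_mul]
        exact mul_le_one₀ (abs_iteratedDeriv_cos_le_one _ _) (abs_nonneg _) (Real.abs_sin_le_one _)
      have hy := mul_mul_le_young (f := Y p) (g := (dθ^[i - b] φ) p.1 p.2) ht hε1
      have e : ((i + 2).choose (b + 2) : ℝ) * iteratedDeriv (b + 2) Real.cos p.2 * (dθ^[i - b] φ) p.1 p.2 * (Real.sin p.2 * Y p) =
          ((i + 2).choose (b + 2) : ℝ) * (iteratedDeriv (b + 2) Real.cos p.2 * Real.sin p.2 * Y p * (dθ^[i - b] φ) p.1 p.2) := by ring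
      rw [e]
      have h2 : ((i + 2).choose (b + 2) : ℝ) * (iteratedDeriv (b + 2) Real.cos p.2 * Real.sin p.2 * Y p * (dθ^[i - b] φ) p.1 p.2) ≤
          (2 : ℝ) ^ (i + 2) * (ε * Y p ^ 2 + 1 / (4 * ε) * (dθ^[i - b] φ) p.1 p.2 ^ 2) := by
        have hnn : 0 ≤ ε * Y p ^ 2 + 1 / (4 * ε) * (dθ^[i - b] φ) p.1 p.2 ^ 2 := by positivity
        calc _ ≤ ((i + 2).choose (b + 2) : ℝ) * (ε * Y p ^ 2 + 1 / (4 * ε) * (dθ^[i - b] φ) p.1 p.2 ^ 2) :=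
              mul_le_mul_of_nonneg_left hy hC0
          _ ≤ _ := mul_le_mul_of_nonneg_right hC hnn
      have := mul_le_mul_of_nonneg_left h2 (mul_nonneg hw hρ')
      nlinarith [this])
    rw [MeasureTheory.integral_const_mul, integral_add ((iYY.const_mul _).integrableOn) (((iL b).const_mul _).integrableOn),
      MeasureTheory.integral_const_mul, MeasureTheory.integral_const_mul] at hmono
    exact hmono
  -- (Ba): each `a'`
  have hε2 : (0 : ℝ) < 1 / (8 * ((i : ℝ) + 1) * 2 ^ (i + 1)) := by positivity
  have hTa_le : ∀ a' ∈ range (i + 1), (∫ p in strip, W p.1 * Ta a' p * Real.sin (2 * p.2) ^ r) ≤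
      (2 : ℝ) ^ (i + 1) * (1 / (8 * ((i : ℝ) + 1) * 2 ^ (i + 1)) * (∫ p in strip, W p.1 * X p ^ 2 * Real.sin (2 * p.2) ^ r) +
        1 / (4 * (1 / (8 * ((i : ℝ) + 1) * 2 ^ (i + 1)))) * ∫ p in strip, W p.1 * (dθ^[i - a'] φ) p.1 p.2 ^ 2 * Real.sin (2 * p.2) ^ r) := by
    intro a' ha'
    set ε : ℝ := 1 / (8 * ((i : ℝ) + 1) * 2 ^ (i + 1)) with hε
    have hC : ((i + 1).choose (a' + 1) : ℝ) ≤ 2 ^ (i + 1) := by exact_mod_cast Nat.choose_le_two_pow (i + 1) (a' + 1)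
    have hC0 : (0 : ℝ) ≤ ((i + 1).choose (a' + 1) : ℝ) := Nat.cast_nonneg _
    have iR : Integrable fun p : ℝ × ℝ => (2 : ℝ) ^ (i + 1) * (ε * (W p.1 * X p ^ 2 * Real.sin (2 * p.2) ^ r) +
        1 / (4 * ε) * (W p.1 * (dθ^[i - a'] φ) p.1 p.2 ^ 2 * Real.sin (2 * p.2) ^ r)) := ((iXX.const_mul _).add ((iL a').const_mul _)).const_mul _
    have hmono := setIntegral_mono_on (s := strip) (iTa a' ha').integrableOn iR.integrableOn measurableSet_strip (fun p hp => by
      have hw := hW0 p.1 hp.1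
      have hρ' : 0 ≤ Real.sin (2 * p.2) ^ r := Real.rpow_nonneg (hsin p hp).le _
      rw [hTa]; simp only []
      have ht : |iteratedDeriv (a' + 1) Real.sin p.2| ≤ 1 := abs_iteratedDeriv_sin_le_one _ _
      have hy := mul_mul_le_young (f := X p) (g := (dθ^[i - a'] φ) p.1 p.2) ht hε2
      have e : ((i + 1).choose (a' + 1) : ℝ) * iteratedDeriv (a' + 1) Real.sin p.2 * (dθ^[i - a'] φ) p.1 p.2 * X p =
          ((i + 1).choose (a' + 1) : ℝ) * (iteratedDeriv (a' + 1) Real.sin p.2 * X p * (dθ^[i - a'] φ) p.1 p.2) := by ring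
      rw [e]
      have h2 : ((i + 1).choose (a' + 1) : ℝ) * (iteratedDeriv (a' + 1) Real.sin p.2 * X p * (dθ^[i - a'] φ) p.1 p.2) ≤
          (2 : ℝ) ^ (i + 1) * (ε * X p ^ 2 + 1 / (4 * ε) * (dθ^[i - a'] φ) p.1 p.2 ^ 2) := by
        have hnn : 0 ≤ ε * X p ^ 2 + 1 / (4 * ε) * (dθ^[i - a'] φ) p.1 p.2 ^ 2 := by positivity
        calc _ ≤ ((i + 1).choose (a' + 1) : ℝ) * (ε * X p ^ 2 + 1 / (4 * ε) * (dθ^[i - a'] φ) p.1 p.2 ^ 2) :=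
              mul_le_mul_of_nonneg_left hy hC0
          _ ≤ _ := mul_le_mul_of_nonneg_right hC hnn
      have := mul_le_mul_of_nonneg_left h2 (mul_nonneg hw hρ')
      nlinarith [this])
    rw [MeasureTheory.integral_const_mul, integral_add ((iXX.const_mul _).integrableOn) (((iL a').const_mul _).integrableOn),
      MeasureTheory.integral_const_mul, MeasureTheory.integral_const_mul] at hmono
    exact hmono
  -- (q): the good coefficient
  have hq : (1 / 2) * (∫ p in strip, W p.1 * Y p ^ 2 * Real.sin (2 * p.2) ^ r) ≤
      ((i : ℝ) + 2) * (∫ p in strip, W p.1 * (Real.sin p.2 ^ 2 * Y p ^ 2) * Real.sin (2 * p.2) ^ r) +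
        (r + 1) / 2 * ∫ p in strip, W p.1 * (Real.cos (2 * p.2) * Y p ^ 2) * Real.sin (2 * p.2) ^ r := by
    rw [← MeasureTheory.integral_const_mul, ← MeasureTheory.integral_const_mul, ← MeasureTheory.integral_const_mul,
      ← integral_add ((iSY.const_mul _).integrableOn) ((iCY.const_mul _).integrableOn)]
    refine setIntegral_mono_on (iYY.const_mul _).integrableOn ((iSY.const_mul _).add (iCY.const_mul _)).integrableOn measurableSet_strip
      fun p hp => ?_
    have hw := hW0 p.1 hp.1
    have hρ' : 0 ≤ Real.sin (2 * p.2) ^ r := Real.rpow_nonneg (hsin p hp).le _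
    have hc := level_coeff_ge_half (i := i) hr0 hr1 p.2
    have := mul_le_mul_of_nonneg_left hc (mul_nonneg (mul_nonneg hw (sq_nonneg (Y p))) hρ')
    nlinarith [this]
  ----------------------------------------------------------------
  -- sum the lower-order bounds
  ----------------------------------------------------------------
  obtain ⟨N, hN⟩ : ∃ N : ℕ → ℝ, N = fun m => ∫ p in strip, W p.1 * (dθ^[m] φ) p.1 p.2 ^ 2 * Real.sin (2 * p.2) ^ r := ⟨_, rfl⟩
  have hNnn : ∀ m, 0 ≤ N m := fun m => by
    rw [hN]; exact setIntegral_nonneg measurableSet_strip fun p hp =>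
      mul_nonneg (mul_nonneg (hW0 p.1 hp.1) (sq_nonneg _)) (Real.rpow_nonneg (hsin p hp).le _)
  have hSN : ∑ b ∈ range (i + 1), N (i - b) = ∑ m ∈ range (i + 1), N m := by
    have := Finset.sum_range_reflect N (i + 1)
    simp only [Nat.add_sub_cancel] at this
    exact this
  have hSNnn : 0 ≤ ∑ m ∈ range (i + 1), N m := Finset.sum_nonneg fun m _ => hNnn m
  -- Σ_b
  have hSb : (∑ b ∈ range (i + 1), ∫ p in strip, W p.1 * Tb b p * Real.sin (2 * p.2) ^ r) ≤
      (1 / 8) * (∫ p in strip, W p.1 * Y p ^ 2 * Real.sin (2 * p.2) ^ r) +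
        (2 * ((i : ℝ) + 1) * 4 ^ (i + 2)) * ∑ m ∈ range (i + 1), N m := by
    have h1 : (∑ b ∈ range (i + 1), ∫ p in strip, W p.1 * Tb b p * Real.sin (2 * p.2) ^ r) ≤
        ∑ b ∈ range (i + 1), ((2 : ℝ) ^ (i + 2) * (1 / (8 * ((i : ℝ) + 1) * 2 ^ (i + 2)) * (∫ p in strip, W p.1 * Y p ^ 2 * Real.sin (2 * p.2) ^ r) +
          1 / (4 * (1 / (8 * ((i : ℝ) + 1) * 2 ^ (i + 2)))) * N (i - b))) := by
      refine Finset.sum_le_sum fun b hb => ?_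
      have := hTb_le b hb
      rw [hN]; exact this
    rw [← Finset.mul_sum, Finset.sum_add_distrib, Finset.sum_const, Finset.card_range, ← Finset.mul_sum, hSN, nsmul_eq_mul] at h1
    push_cast at h1
    have hJ : (i : ℝ) + 1 ≠ 0 := by positivity
    have hE : (2 : ℝ) ^ (i + 2) ≠ 0 := by positivity
    have e4 : (4 : ℝ) ^ (i + 2) = 2 ^ (i + 2) * 2 ^ (i + 2) := by rw [← mul_pow]; norm_num
    have c1 : (2 : ℝ) ^ (i + 2) * (((i : ℝ) + 1) * (1 / (8 * ((i : ℝ) + 1) * 2 ^ (i + 2)))) = 1 / 8 := by field_simp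
    have c2 : (2 : ℝ) ^ (i + 2) * (1 / (4 * (1 / (8 * ((i : ℝ) + 1) * 2 ^ (i + 2))))) = 2 * ((i : ℝ) + 1) * 4 ^ (i + 2) := by
      rw [e4]; field_simp; ring
    refine h1.trans (le_of_eq ?_)
    calc (2 : ℝ) ^ (i + 2) * (((i : ℝ) + 1) * (1 / (8 * ((i : ℝ) + 1) * 2 ^ (i + 2)) * ∫ p in strip, W p.1 * Y p ^ 2 * Real.sin (2 * p.2) ^ r) +
          1 / (4 * (1 / (8 * ((i : ℝ) + 1) * 2 ^ (i + 2)))) * ∑ m ∈ range (i + 1), N m)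
        = (2 : ℝ) ^ (i + 2) * (((i : ℝ) + 1) * (1 / (8 * ((i : ℝ) + 1) * 2 ^ (i + 2)))) * (∫ p in strip, W p.1 * Y p ^ 2 * Real.sin (2 * p.2) ^ r) +
          (2 : ℝ) ^ (i + 2) * (1 / (4 * (1 / (8 * ((i : ℝ) + 1) * 2 ^ (i + 2))))) * ∑ m ∈ range (i + 1), N m := by ring
      _ = _ := by rw [c1, c2]
  -- Σ_a
  have hSa : (∑ a' ∈ range (i + 1), ∫ p in strip, W p.1 * Ta a' p * Real.sin (2 * p.2) ^ r) ≤
      (1 / 8) * (∫ p in strip, W p.1 * X p ^ 2 * Real.sin (2 * p.2) ^ r) +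
        (2 * ((i : ℝ) + 1) * 4 ^ (i + 1)) * ∑ m ∈ range (i + 1), N m := by
    have h1 : (∑ a' ∈ range (i + 1), ∫ p in strip, W p.1 * Ta a' p * Real.sin (2 * p.2) ^ r) ≤
        ∑ a' ∈ range (i + 1), ((2 : ℝ) ^ (i + 1) * (1 / (8 * ((i : ℝ) + 1) * 2 ^ (i + 1)) * (∫ p in strip, W p.1 * X p ^ 2 * Real.sin (2 * p.2) ^ r) +
          1 / (4 * (1 / (8 * ((i : ℝ) + 1) * 2 ^ (i + 1)))) * N (i - a'))) := by
      refine Finset.sum_le_sum fun a' ha' => ?_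
      have := hTa_le a' ha'
      rw [hN]; exact this
    rw [← Finset.mul_sum, Finset.sum_add_distrib, Finset.sum_const, Finset.card_range, ← Finset.mul_sum, hSN, nsmul_eq_mul] at h1
    push_cast at h1
    have hJ : (i : ℝ) + 1 ≠ 0 := by positivity
    have hE : (2 : ℝ) ^ (i + 1) ≠ 0 := by positivity
    have e4 : (4 : ℝ) ^ (i + 1) = 2 ^ (i + 1) * 2 ^ (i + 1) := by rw [← mul_pow]; norm_num
    have c1 : (2 : ℝ) ^ (i + 1) * (((i : ℝ) + 1) * (1 / (8 * ((i : ℝ) + 1) * 2 ^ (i + 1)))) = 1 / 8 := by field_simp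
    have c2 : (2 : ℝ) ^ (i + 1) * (1 / (4 * (1 / (8 * ((i : ℝ) + 1) * 2 ^ (i + 1))))) = 2 * ((i : ℝ) + 1) * 4 ^ (i + 1) := by
      rw [e4]; field_simp; ring
    refine h1.trans (le_of_eq ?_)
    calc (2 : ℝ) ^ (i + 1) * (((i : ℝ) + 1) * (1 / (8 * ((i : ℝ) + 1) * 2 ^ (i + 1)) * ∫ p in strip, W p.1 * X p ^ 2 * Real.sin (2 * p.2) ^ r) +
          1 / (4 * (1 / (8 * ((i : ℝ) + 1) * 2 ^ (i + 1)))) * ∑ m ∈ range (i + 1), N m)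
        = (2 : ℝ) ^ (i + 1) * (((i : ℝ) + 1) * (1 / (8 * ((i : ℝ) + 1) * 2 ^ (i + 1)))) * (∫ p in strip, W p.1 * X p ^ 2 * Real.sin (2 * p.2) ^ r) +
          (2 : ℝ) ^ (i + 1) * (1 / (4 * (1 / (8 * ((i : ℝ) + 1) * 2 ^ (i + 1))))) * ∑ m ∈ range (i + 1), N m := by ring
      _ = _ := by rw [c1, c2]
  ----------------------------------------------------------------
  -- the algebra on named reals
  ----------------------------------------------------------------
  have hK : 8 * (2 * ((i : ℝ) + 1) * 4 ^ (i + 2) + 2 * ((i : ℝ) + 1) * 4 ^ (i + 1)) ≤ 3 * (((i : ℝ) + 1) * 4 ^ (i + 4)) := by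
    have h4 : (4 : ℝ) ^ (i + 4) = 16 * 4 ^ (i + 2) := by rw [pow_add]; norm_num; ring
    have h4' : (4 : ℝ) ^ (i + 2) = 4 * 4 ^ (i + 1) := by rw [pow_succ]; ring
    have hi0 : (0 : ℝ) ≤ (i : ℝ) + 1 := by positivity
    have hp : (0 : ℝ) ≤ 4 ^ (i + 1) := by positivity
    rw [h4, h4']
    nlinarith [mul_nonneg hi0 hp]
  have hMnn : 0 ≤ ∫ p in strip, W p.1 * X p ^ 2 * Real.sin (2 * p.2) ^ r :=
    setIntegral_nonneg measurableSet_strip fun p hp => mul_nonneg (mul_nonneg (hW0 p.1 hp.1) (sq_nonneg _)) (Real.rpow_nonneg (hsin p hp).le _)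
  have hAnn : 0 ≤ ∫ p in strip, W p.1 * A p ^ 2 * Real.sin (2 * p.2) ^ r :=
    setIntegral_nonneg measurableSet_strip fun p hp => mul_nonneg (mul_nonneg (hW0 p.1 hp.1) (sq_nonneg _)) (Real.rpow_nonneg (hsin p hp).le _)
  have hid : (∫ p in strip, W p.1 * X p ^ 2 * Real.sin (2 * p.2) ^ r) +
      (((i : ℝ) + 2) * (∫ p in strip, W p.1 * (Real.sin p.2 ^ 2 * Y p ^ 2) * Real.sin (2 * p.2) ^ r) +
        (r + 1) / 2 * ∫ p in strip, W p.1 * (Real.cos (2 * p.2) * Y p ^ 2) * Real.sin (2 * p.2) ^ r) =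
      (∫ p in strip, W p.1 * (-(A p * X p)) * Real.sin (2 * p.2) ^ r) +
      (∑ b ∈ range (i + 1), ∫ p in strip, W p.1 * Tb b p * Real.sin (2 * p.2) ^ r) +
      ∑ a' ∈ range (i + 1), ∫ p in strip, W p.1 * Ta a' p * Real.sin (2 * p.2) ^ r := by
    rw [hIBP] at hInt; linear_combination hInt
  have hfinal := level_algebra (K := ((i : ℝ) + 1) * 4 ^ (i + 4)) hMnn hAnn hSNnn hid hq hB0 hSb hSa hK
  -- unfold the names in the conclusion
  have eY : (∫ p in strip, W p.1 * (dθ^[i + 1] φ) p.1 p.2 ^ 2 * Real.sin (2 * p.2) ^ r) = ∫ p in strip, W p.1 * Y p ^ 2 * Real.sin (2 * p.2) ^ r := by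
    rw [hY]
  have eX : (∫ p in strip, W p.1 * (dθ^[i + 2] Φ) p.1 p.2 ^ 2 * Real.sin (2 * p.2) ^ r) = ∫ p in strip, W p.1 * X p ^ 2 * Real.sin (2 * p.2) ^ r := by
    rw [hX]
  have eA : (∫ p in strip, W p.1 * (-(dθ^[i + 2] Φ) p.1 p.2 + (dθ^[i + 1] fun R θ => Real.sin θ * φ R θ) p.1 p.2) ^ 2 * Real.sin (2 * p.2) ^ r) =
      ∫ p in strip, W p.1 * A p ^ 2 * Real.sin (2 * p.2) ^ r := by
    rw [hA, hS]
  have eN : (∑ m ∈ range (i + 1), ∫ p in strip, W p.1 * (dθ^[m] φ) p.1 p.2 ^ 2 * Real.sin (2 * p.2) ^ r) = ∑ m ∈ range (i + 1), N m := by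
    rw [hN]
  rw [eY, eX, eA, eN]
  exact hfinal

end Elgindi

end Literature.Analysis.FluidPDE
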